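import Summits.QuantumFields.BalabanUV.T4Continuum.Support.NE3TentBumpSharp
import HarnessLib

/-!
# T⁴ programme, node NE3 — route Π, row Π-R («SMOOTH RIGHT INVERSE of the linearised average», D-ne3p1-g24-1 §6), file Π-R♭-1:
# THE SIGNED LONGITUDINAL PROFILE — invisible to the far block of the straight-line tent kernel, non-degenerate on the near block

NE3 (node U1b) formalisation swarm, leaf seat `b2b-balaban-t4-ne3-formalise-leaf-01` (gen 7); design finding D-ne3leaf01g7-1 (`HOME/CLAIMS.log` l.21412,
memo `HOME/b2b-balaban-t4-ne3-formalise-leaf-01/g7/PI-R-DESIGN-leaf01g7.md` v2).  WHY.  At the flat background the linearised one-step average is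
`linQ − d∘F̂` (tree `NE3TangentFlatPush.cpush_flatCfg` = Literature `B7Prop3Flat.frame_cancellation`), and the k-fold iterate of `linQ_L` is the single-scale
straight-line average over `M = L^k`-blocks (Literature `B7Prop4Flat.linQIter_eq_linQ_pow`), whose kernel along a direction κ is the TWO-BLOCK TENT
`M^{−d}·[Σ_t (t+1)·A(block y; t) + Σ_t (M−1−t)·A(block y+e_κ; t)]` (`t` = κ-offset).  A lift `A(z) = g(t_κ(z))·T⊥(z⊥)·φ(y,κ)∕c` reproduces `φ` EXACTLY under
`linQ_M` iff its longitudinal profile satisfies **(E1) `Σ_{t<M} (M−1−t)·g(t) = 0`** and **(E2) `Σ_{t<M} (t+1)·g(t) ≠ 0`**; a NONNEGATIVE profile cannot meet (E1)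
except the far-slice spike `δ_{M−1}` (the spread lift, exact but not smooth) — a SIGNED smooth profile can.

CONTENT ([folklore]; 0 sorry; ONE data def): **`lprof M t := (t∕M)(1 − t∕M)(5t − 2M + 1)`** (vanishes at `t = 0` and `t = M`; changes sign at `t = (2M−1)∕5`);
§1 `sum_range_pow_five`-free power sums (degrees ≤ 4 from F♯1 `NE3TentBumpSharp.sum_range_pow_two_three_four`) and the two identities
   **`sum_far_weight_lprof`** `Σ_{t<M} (M−1−t)·lprof M t = 0` (E1), **`sum_near_weight_lprof`** `Σ_{t<M} (t+1)·lprof M t = (M−1)(M+1)(M+2)∕12` (E2);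
§2 sizes: `lprof_zero`, `lprof_self` (`= 0` at `t = M`), `abs_lprof_le` (`≤ M` on `0 ≤ t ≤ M`), `abs_lprof_succ_sub_le` (`≤ 6`, the profile is Lipschitz at scale 1,
   i.e. smooth at scale `M` after the `1∕N ≈ 12∕M³` normalisation).
Π-R♭-2 (`NE3SmoothLiftFlat`) builds the lift and proves `linQ_M ∘ smoothLift = id` from (E1)(E2); Π-R♭-3∕4 add the accumulated frame potential and the
curl-free pure-gauge corrector (`cpush_flatCfg_gaugeDir`) for the EXACT right inverse of the k-fold `cpushIter` at `W = 1`.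

HONEST FRAMING.  Elementary profile arithmetic for OUR lift; nothing about Bałaban's minimisers or his `H` ([B9] Thm 3.12 is the non-local analogue,
TYPE only); the owner's SHAPE `SmoothLift` is asserted for nothing here; (P♮)_W, T-E_w and **NE3 are NOT proved**; spine PROVED 0∕9; finite T⁴ rung
(B)+1 — NOT infinite volume, NOT mass gap, NOT `BetaPertH`, NOT Clay.  PLACEMENT: `Summits/QuantumFields/BalabanUV/`.  HONEST DEPENDENCY (cell page 1):
continuum YM on T⁴ ⇐ BetaPertH ∧ nine spine estimates (0/9 proved); BetaPertH ⇐ (D1) ∧ (D4) ∧ CAP+tail; G-an2-4 gates asym, D1 and NE2/3/4.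
-/

set_option autoImplicit false

open scoped BigOperators
open Finset

namespace Summit.QuantumFields.BalabanUV.T4Continuum.NE3SmoothLiftProfile

open NE3TentBumpSharp (sum_range_pow_two_three_four)

noncomputable section

/-- **THE SIGNED LONGITUDINAL PROFILE** `lprof M t = (t∕M)(1 − t∕M)(5t − 2M + 1)` (real-valued, integer offset `t`). [folklore] -/
def lprof (M : ℕ) (t : ℤ) : ℝ := ((t : ℝ) / M) * (1 - (t : ℝ) / M) * (5 * (t : ℝ) - 2 * M + 1)

/-! ## §1 The two weighted sums -/

/-- `Σ_{t<M} t = M(M−1)∕2` and `Σ_{t<M} 1 = M` packaged with the higher power sums. [folklore] -/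
theorem sum_range_pow_one (M : ℕ) : (∑ t ∈ Finset.range M, (t : ℝ)) = (M : ℝ) * ((M : ℝ) - 1) / 2 :=
  (NE3TentBump.sum_range_mul_sub M).1

/-- **(E1) THE PROFILE IS INVISIBLE TO THE FAR BLOCK**: `Σ_{t<M} (M−1−t)·lprof M t = 0`. [folklore] -/
theorem sum_far_weight_lprof (M : ℕ) (hM : 1 ≤ M) :
    ∑ t : Fin M, (((M : ℝ)) - 1 - ((t : ℕ) : ℝ)) * lprof M ((t : ℕ) : ℤ) = 0 := by
  have hM0 : (M : ℝ) ≠ 0 := by exact_mod_cast (by omega : M ≠ 0)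
  obtain ⟨h2, h3, h4⟩ := sum_range_pow_two_three_four M
  have h1 := sum_range_pow_one M
  rw [Fin.sum_univ_eq_sum_range (fun t => (((M : ℝ)) - 1 - (t : ℝ)) * lprof M (t : ℤ)) M]
  have hterm : ∀ t ∈ Finset.range M, (((M : ℝ)) - 1 - (t : ℝ)) * lprof M (t : ℤ)
      = (1 / (M : ℝ) ^ 2) * ((M : ℝ) * ((M : ℝ) - 1) * (1 - 2 * M) * (t : ℝ)
          + (9 * (M : ℝ) ^ 2 - 9 * M + 1) * (t : ℝ) ^ 2 + (6 - 12 * (M : ℝ)) * (t : ℝ) ^ 3 + 5 * (t : ℝ) ^ 4) := by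
    intro t _
    simp only [lprof, Int.cast_natCast]
    field_simp
    ring
  rw [Finset.sum_congr rfl hterm, ← Finset.mul_sum, Finset.sum_add_distrib, Finset.sum_add_distrib, Finset.sum_add_distrib,
    ← Finset.mul_sum, ← Finset.mul_sum, ← Finset.mul_sum, ← Finset.mul_sum, h1, h2, h3, h4]
  field_simp
  ring

/-- **(E2) THE PROFILE IS NON-DEGENERATE ON THE NEAR BLOCK**: `Σ_{t<M} (t+1)·lprof M t = (M−1)(M+1)(M+2)∕12`. [folklore] -/
theorem sum_near_weight_lprof (M : ℕ) (hM : 1 ≤ M) :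
    ∑ t : Fin M, (((t : ℕ) : ℝ) + 1) * lprof M ((t : ℕ) : ℤ) = (((M : ℝ)) - 1) * ((M : ℝ) + 1) * ((M : ℝ) + 2) / 12 := by
  have hM0 : (M : ℝ) ≠ 0 := by exact_mod_cast (by omega : M ≠ 0)
  obtain ⟨h2, h3, h4⟩ := sum_range_pow_two_three_four M
  have h1 := sum_range_pow_one M
  rw [Fin.sum_univ_eq_sum_range (fun t => ((t : ℝ) + 1) * lprof M (t : ℤ)) M]
  have hterm : ∀ t ∈ Finset.range M, ((t : ℝ) + 1) * lprof M (t : ℤ)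
      = (1 / (M : ℝ) ^ 2) * (((M : ℝ) - 2 * (M : ℝ) ^ 2) * (t : ℝ)
          + (-2 * (M : ℝ) ^ 2 + 8 * M - 1) * (t : ℝ) ^ 2 + (7 * (M : ℝ) - 6) * (t : ℝ) ^ 3 - 5 * (t : ℝ) ^ 4) := by
    intro t _
    simp only [lprof, Int.cast_natCast]
    field_simp
    ring
  rw [Finset.sum_congr rfl hterm, ← Finset.mul_sum, Finset.sum_sub_distrib, Finset.sum_add_distrib, Finset.sum_add_distrib,
    ← Finset.mul_sum, ← Finset.mul_sum, ← Finset.mul_sum, ← Finset.mul_sum, h1, h2, h3, h4]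
  field_simp
  ring

/-! ## §2 Sizes: boundary values, sup, increments -/

/-- The profile vanishes at the near end. [folklore] -/
theorem lprof_zero (M : ℕ) : lprof M 0 = 0 := by simp [lprof]

/-- The profile vanishes at the far end `t = M` (so the lift vanishes on the far block face). [folklore] -/
theorem lprof_self (M : ℕ) (hM : 1 ≤ M) : lprof M (M : ℤ) = 0 := by
  have hM0 : (M : ℝ) ≠ 0 := by exact_mod_cast (by omega : M ≠ 0)
  simp [lprof, div_self hM0]

/-- **SUP BOUND**: `|lprof M t| ≤ M` for `0 ≤ t ≤ M` (`(t∕M)(1−t∕M) ≤ 1∕4 ≤ 1`, `|5t − 2M + 1| ≤ 3M + 1 ≤ 4M`; crude). [folklore] -/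
theorem abs_lprof_le {M : ℕ} (hM : 1 ≤ M) {t : ℤ} (ht0 : 0 ≤ t) (htM : t ≤ (M : ℤ)) : |lprof M t| ≤ (M : ℝ) := by
  have hM0 : (0 : ℝ) < M := by exact_mod_cast (by omega : 0 < M)
  have ht0' : (0 : ℝ) ≤ (t : ℝ) := by exact_mod_cast ht0
  have htM' : (t : ℝ) ≤ (M : ℝ) := by exact_mod_cast htM
  have hu0 : 0 ≤ (t : ℝ) / M := div_nonneg ht0' hM0.le
  have hu1 : (t : ℝ) / M ≤ 1 := by rw [div_le_one hM0]; exact htM'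
  have hfac : |((t : ℝ) / M) * (1 - (t : ℝ) / M)| ≤ 1 / 4 := by
    rw [abs_of_nonneg (mul_nonneg hu0 (by linarith))]
    nlinarith [sq_nonneg ((t : ℝ) / M - 1 / 2)]
  have hlin : |5 * (t : ℝ) - 2 * M + 1| ≤ 4 * M := by
    rw [abs_le]; constructor <;> nlinarith [hM0, show (1 : ℝ) ≤ M by exact_mod_cast hM]
  unfold lprof
  rw [abs_mul]
  calc |((t : ℝ) / M) * (1 - (t : ℝ) / M)| * |5 * (t : ℝ) - 2 * M + 1| ≤ (1 / 4) * (4 * M) :=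
        mul_le_mul hfac hlin (abs_nonneg _) (by norm_num)
    _ = M := by ring

/-- **INCREMENT BOUND**: `|lprof M (t+1) − lprof M t| ≤ 6` for `0 ≤ t`, `t + 1 ≤ M` — the un-normalised profile is Lipschitz at scale `1`;
after the `1∕N(M) = 12∕((M−1)(M+1)(M+2))` normalisation of (E2) it moves by `O(M^{−3})` per step. [folklore] -/
theorem abs_lprof_succ_sub_le {M : ℕ} (hM : 1 ≤ M) {t : ℤ} (ht0 : 0 ≤ t) (htM : t + 1 ≤ (M : ℤ)) :
    |lprof M (t + 1) - lprof M t| ≤ 6 := by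
  have hM0 : (0 : ℝ) < M := by exact_mod_cast (by omega : 0 < M)
  have hM1 : (1 : ℝ) ≤ M := by exact_mod_cast hM
  have ht0' : (0 : ℝ) ≤ (t : ℝ) := by exact_mod_cast ht0
  have htM' : (t : ℝ) + 1 ≤ (M : ℝ) := by exact_mod_cast htM
  set u : ℝ := (t : ℝ) / M with hu
  set h : ℝ := 1 / (M : ℝ) with hh
  have hu0 : 0 ≤ u := div_nonneg ht0' hM0.le
  have huh : u + h ≤ 1 := by rw [hu, hh, ← add_div, div_le_one hM0]; exact htM'
  have hh0 : 0 < h := by rw [hh]; positivity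
  have hh1 : h ≤ 1 := by rw [hh, div_le_one hM0]; exact hM1
  have hMh : (M : ℝ) * h = 1 := by rw [hh]; field_simp
  -- write both values in terms of `u`, `h`, `M`
  have e0 : lprof M t = u * (1 - u) * (5 * M * u - 2 * M + 1) := by
    simp only [lprof, ← hu]
    congr 1
    rw [hu]; field_simp
  have e1 : lprof M (t + 1) = (u + h) * (1 - (u + h)) * (5 * M * (u + h) - 2 * M + 1) := by
    have : (((t + 1 : ℤ) : ℝ)) / M = u + h := by rw [hu, hh]; push_cast; ring
    simp only [lprof, this]
    congr 1
    rw [hu, hh]; push_cast; field_simp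
  rw [e1, e0]
  -- the difference is `h·P(u,h,M)` with `M·h = 1`; bound the polynomial on the unit box
  have hid : (u + h) * (1 - (u + h)) * (5 * M * (u + h) - 2 * M + 1) - u * (1 - u) * (5 * M * u - 2 * M + 1)
      = (M * h) * ((1 - 2 * u - h) * (5 * (u + h) - 2) + u * (1 - u) * 5) + h * (1 - 2 * u - h) := by ring
  rw [hid, hMh, one_mul, abs_le]
  have hu1 : u ≤ 1 := by linarith
  constructor <;> nlinarith [mul_nonneg hu0 (sub_nonneg.mpr hu1), mul_nonneg hh0.le hu0, mul_nonneg hh0.le (sub_nonneg.mpr hu1),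
    mul_nonneg hh0.le hh0.le, sq_nonneg u, sq_nonneg h]

end

end Summit.QuantumFields.BalabanUV.T4Continuum.NE3SmoothLiftProfile
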